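import Summits.AtomisticToContinuum.HydrodynamicLimit.Theorems.JParityClosureRateFloorNoBurstsRung0Statics
import HarnessLib

/-!
# Splitting floor at rung 0 (helper of `stub_splitFloorRung0`, line `level-census-comparison`, crux
# `EnergyCurrentTails`, stmt-AtomisticToContinuum-9235): the pair excess of would-be pairs is `O_N(h²)`

The fixed-`N` small-window argument of the rung-0 certificate `stub_splitFloorRung0` of the splitting floor F3
bounds the expected number of splitting collisions in a window of length `h` from BELOW by the static would-be
marked sum minus the PAIR EXCESS `D_h(w) = Σ_{p ∈ W_h(w)} #{q ∈ W_h(w) : q ∉ {p, p.swap}}` of the ordered would-be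
pairs `W_h(w) = wouldBePairs ε h w` (`…RateFloorLineDefs`): if at most one unordered pair is would-be within `h`,
it is realised.  THIS FILE (registered helper `splitFloorRung0_statics`): under the homogeneous Gibbs law `G_N`
(constant profiles, small density) `D_h` has a measurable majorant `M` with `E_{G_N}[M] ≤ C_N h²` (`N`-dependence
irrelevant: `h → 0` at fixed `N`).  A nonzero excess exhibits a would-be TRIPLE `(a,b), (a,c)` or two DISJOINT
would-be pairs (`exists_shape_of_ne`); a would-be pair puts a lattice lift of the relative position in a forward
swept tube of volume `≤ 4ε²h‖v − w‖` (`RateFloorNoBursts.exists_latticeVec_mem_of_wouldBe`, `exists_sweptTube`);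
the three-label Ruelle statics is the tree's `measure_windowEvent_inter_tubeEvent_le` (`posGibbs_tripleEvent_le`),
the four-label one (`measure_tubeEvent_inter_tubeEvent_le`, from `posGibbs_quadEvent_le`) is proved here along
the same lines; both are `≤ 256 ε⁴ h² E‖w − v‖²`.

References: D. Ruelle, *Statistical Mechanics: Rigorous Results* (1969) §4.2; Cercignani–Illner–Pulvirenti 1994.
-/

noncomputable section

open scoped BigOperators Topology ENNReal NNReal Classical
open MeasureTheory Set Filter Function
open Literature.Analysis.FluidPDE Literature.Analysis.FunctionSpaces Literature.MathematicalPhysics.KineticTheory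

namespace Summit.AtomisticToContinuum.HydrodynamicLimit.Theorems.EnergyCurrentTailsLevelCensus

open RateFloorLine RateFloorNoBursts

/-! ## Four-label statics: two tube events on disjoint pairs -/

-- adapted from Literature/MathematicalPhysics/KineticTheory/ShortFlightCount.lean
-- (`measure_windowEvent_inter_tubeEvent_le`, three labels ↦ four labels)
/-- **Four-label statics of two tube events.**  Under the rung-0 law, for `i ≠ j`, `k ≠ l` with the
four-label canonical bound `hquad` (`≤ 16 vol T · vol T'`, Ruelle), a swept-tube family `Sh` of window length
`h` (`vol ≤ 4ε²h‖u‖`) and the minimal-image lift inequality `hlift`: the probability that a lift of `x_j − x_i`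
lies in `Sh(v_i − v_j)` AND a lift of `x_l − x_k` lies in `Sh(v_k − v_l)` is at most `256 ε⁴ h² · E‖w − v‖²`.
[folklore] -/
theorem measure_tubeEvent_inter_tubeEvent_le {σ : ℝ} (hσ2 : σ ≤ 1 / 2) {a θ : ℝ} (ha : 0 < a)
    (hθ : 0 < θ) (u : V3) {N : ℕ} (Φ : HardSphereFlow (Torus.geometry (Fin 3)) (hsDiameter σ N) (N + 1))
    {i j k l : Fin (N + 1)} (hij : i ≠ j) (hkl : k ≠ l)
    (hquad : ∀ T T' : Set T3, MeasurableSet T → MeasurableSet T' →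
      posGibbsMeasure (fun _ : T3 => (1 : ℝ)) (hsDiameter σ N) (N + 1) {x | x j - x i ∈ T ∧ x l - x k ∈ T'} ≤
        16 * (volume T * volume T'))
    {h : ℝ} (hh : 0 ≤ h) {Sh : V3 → Set V3} (hShm : MeasurableSet {q : V3 × V3 | q.1 ∈ Sh q.2})
    (hShvol : ∀ v, volume (Sh v) ≤ ENNReal.ofReal (4 * hsDiameter σ N ^ 2 * h * ‖v‖))
    (hlift : ∀ B : Set V3, MeasurableSet B →
      volume {x : T3 | ∃ k : Fin 3 → ℤ, Torus.reprSym x + Torus.latticeVec k ∈ B} ≤ volume B) :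
    localGibbsLaw σ (fun _ => a) (fun _ => u) (fun _ => θ) N Φ
        ({w | ∃ m : Fin 3 → ℤ, Torus.reprSym ((w j).1 - (w i).1) + Torus.latticeVec m ∈ Sh ((w i).2 - (w j).2)} ∩
          {w | ∃ m : Fin 3 → ℤ, Torus.reprSym ((w l).1 - (w k).1) + Torus.latticeVec m ∈ Sh ((w k).2 - (w l).2)}) ≤
      ENNReal.ofReal (256 * hsDiameter σ N ^ 4 * h ^ 2) *
        ∫⁻ q, ENNReal.ofReal (‖q.2 - q.1‖ ^ 2) ∂((gaussMeasure u θ).prod (gaussMeasure u θ)) := by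
  set ε := hsDiameter σ N with hε
  have hShu : ∀ v : V3, MeasurableSet (Sh v) := fun v => hShm.preimage (measurable_id.prodMk measurable_const)
  -- the position events for fixed velocities
  set T₁ : (Fin (N + 1) → V3) → Set T3 := fun v =>
    {y | ∃ m : Fin 3 → ℤ, Torus.reprSym y + Torus.latticeVec m ∈ Sh (v i - v j)} with hT₁
  set T₂ : (Fin (N + 1) → V3) → Set T3 := fun v =>
    {y | ∃ m : Fin 3 → ℤ, Torus.reprSym y + Torus.latticeVec m ∈ Sh (v k - v l)} with hT₂
  have hpre : ∀ (B : Set V3), MeasurableSet B →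
      MeasurableSet {y : T3 | ∃ m : Fin 3 → ℤ, Torus.reprSym y + Torus.latticeVec m ∈ B} := fun B hB => by
    have : {y : T3 | ∃ m : Fin 3 → ℤ, Torus.reprSym y + Torus.latticeVec m ∈ B} =
        ⋃ m : Fin 3 → ℤ, (fun y : T3 => Torus.reprSym y + Torus.latticeVec m) ⁻¹' B := by
      ext y; simp only [mem_setOf_eq, mem_iUnion, mem_preimage]
    exact this ▸ MeasurableSet.iUnion fun m => hB.preimage (Torus.measurable_reprSym.add_const _)
  have hT₁m : ∀ v, MeasurableSet (T₁ v) := fun v => hpre _ (hShu _)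
  have hT₂m : ∀ v, MeasurableSet (T₂ v) := fun v => hpre _ (hShu _)
  have hT₁vol : ∀ v, volume (T₁ v) ≤ ENNReal.ofReal (4 * ε ^ 2 * h * ‖v i - v j‖) := fun v =>
    (hlift _ (hShu _)).trans (hShvol _)
  have hT₂vol : ∀ v, volume (T₂ v) ≤ ENNReal.ofReal (4 * ε ^ 2 * h * ‖v k - v l‖) := fun v =>
    (hlift _ (hShu _)).trans (hShvol _)
  -- the event and its measurability
  set A : Set (Config (N + 1) (Fin 3) T3) :=
    {w | ∃ m : Fin 3 → ℤ, Torus.reprSym ((w j).1 - (w i).1) + Torus.latticeVec m ∈ Sh ((w i).2 - (w j).2)} ∩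
      {w | ∃ m : Fin 3 → ℤ, Torus.reprSym ((w l).1 - (w k).1) + Torus.latticeVec m ∈ Sh ((w k).2 - (w l).2)}
    with hA
  have hψm : ∀ (i' j' i'' j'' : Fin (N + 1)) (m : Fin 3 → ℤ), Measurable fun w : Config (N + 1) (Fin 3) T3 =>
      (Torus.reprSym ((w i').1 - (w j').1) + Torus.latticeVec m, (w i'').2 - (w j'').2) := fun i' j' i'' j'' m =>
    ((Torus.measurable_reprSym.comp ((measurable_pi_apply i').fst.sub (measurable_pi_apply j').fst)).add_const
      _).prodMk ((measurable_pi_apply i'').snd.sub (measurable_pi_apply j'').snd)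
  have hEv : ∀ i' j' : Fin (N + 1), {w : Config (N + 1) (Fin 3) T3 | ∃ m : Fin 3 → ℤ,
      Torus.reprSym ((w j').1 - (w i').1) + Torus.latticeVec m ∈ Sh ((w i').2 - (w j').2)} =
      ⋃ m : Fin 3 → ℤ, (fun w : Config (N + 1) (Fin 3) T3 =>
        (Torus.reprSym ((w j').1 - (w i').1) + Torus.latticeVec m, (w i').2 - (w j').2)) ⁻¹'
          {q : V3 × V3 | q.1 ∈ Sh q.2} := by
    intro i' j'; ext w; simp only [mem_setOf_eq, mem_iUnion, mem_preimage]
  have hAm : MeasurableSet A := by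
    rw [hA, hEv i j, hEv k l]
    exact (MeasurableSet.iUnion fun m => hShm.preimage (hψm j i i j m)).inter
      (MeasurableSet.iUnion fun m => hShm.preimage (hψm l k k l m))
  -- the rung-0 law
  set Q := posGibbsMeasure (fun _ : T3 => a) ε (N + 1) with hQ
  set Γ : Measure (Fin (N + 1) → V3) := Measure.pi fun _ => gaussMeasure u θ with hΓ
  have hlaw : localGibbsLaw σ (fun _ => a) (fun _ => u) (fun _ => θ) N Φ = (Q.prod Γ).map zipConfig := by
    rw [localGibbsLaw_eq, localGibbsMeasure_rung0_eq_map σ ha.le hθ u N]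
  haveI : IsProbabilityMeasure Q := isProbabilityMeasure_posGibbsMeasure continuous_const (fun _ => ha) hσ2 N
  haveI : IsProbabilityMeasure Γ := by rw [hΓ]; infer_instance
  -- the sections
  have hsec : ∀ v : Fin (N + 1) → V3, Q ((fun x => (x, v)) ⁻¹' (zipConfig ⁻¹' A)) ≤
      ENNReal.ofReal (128 * ε ^ 4 * h ^ 2 * (‖v i - v j‖ ^ 2 + ‖v k - v l‖ ^ 2)) := by
    intro v
    have hset : (fun x => (x, v)) ⁻¹' (zipConfig ⁻¹' A) = {x | x j - x i ∈ T₁ v ∧ x l - x k ∈ T₂ v} := by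
      ext x
      simp only [hA, hT₁, hT₂, mem_preimage, mem_inter_iff, mem_setOf_eq, zipConfig_apply]
    rw [hset, hQ, posGibbsMeasure_const_eq_one ha]
    refine (hquad _ _ (hT₁m v) (hT₂m v)).trans ?_
    calc 16 * (volume (T₁ v) * volume (T₂ v))
        ≤ 16 * (ENNReal.ofReal (4 * ε ^ 2 * h * ‖v i - v j‖) * ENNReal.ofReal (4 * ε ^ 2 * h * ‖v k - v l‖)) :=
          mul_le_mul' le_rfl (mul_le_mul' (hT₁vol v) (hT₂vol v))
      _ = ENNReal.ofReal (16 * ((4 * ε ^ 2 * h * ‖v i - v j‖) * (4 * ε ^ 2 * h * ‖v k - v l‖))) := by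
          rw [← ENNReal.ofReal_mul (by positivity), ← ENNReal.ofReal_ofNat 16, ← ENNReal.ofReal_mul (by norm_num)]
      _ ≤ ENNReal.ofReal (128 * ε ^ 4 * h ^ 2 * (‖v i - v j‖ ^ 2 + ‖v k - v l‖ ^ 2)) := by
          refine ENNReal.ofReal_le_ofReal ?_
          have hab : 2 * (‖v i - v j‖ * ‖v k - v l‖) ≤ ‖v i - v j‖ ^ 2 + ‖v k - v l‖ ^ 2 := by
            nlinarith [sq_nonneg (‖v i - v j‖ - ‖v k - v l‖)]
          have hc : 0 ≤ 128 * ε ^ 4 * h ^ 2 := by positivity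
          nlinarith [mul_le_mul_of_nonneg_left hab hc]
  -- Gaussian second moments of the two relative velocities
  have hmeas2 : ∀ i' j' : Fin (N + 1), Measurable fun v : Fin (N + 1) → V3 => ENNReal.ofReal (‖v i' - v j'‖ ^ 2) :=
    fun i' j' => by fun_prop
  have hpair2 : ∀ i' j' : Fin (N + 1), i' ≠ j' → ∫⁻ v, ENNReal.ofReal (‖v i' - v j'‖ ^ 2) ∂Γ =
      ∫⁻ q, ENNReal.ofReal (‖q.2 - q.1‖ ^ 2) ∂((gaussMeasure u θ).prod (gaussMeasure u θ)) := by
    intro i' j' hij'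
    rw [hΓ, lintegral_pi_pair (gaussMeasure u θ) hij' (f := fun q : V3 × V3 => ENNReal.ofReal (‖q.1 - q.2‖ ^ 2))
      (by fun_prop)]
    refine lintegral_congr fun q => ?_
    rw [norm_sub_rev]
  calc localGibbsLaw σ (fun _ => a) (fun _ => u) (fun _ => θ) N Φ A
      = (Q.prod Γ) (zipConfig ⁻¹' A) := by rw [hlaw, Measure.map_apply measurable_zipConfig hAm]
    _ = ∫⁻ v, Q ((fun x => (x, v)) ⁻¹' (zipConfig ⁻¹' A)) ∂Γ := Measure.prod_apply_symm (measurable_zipConfig hAm)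
    _ ≤ ∫⁻ v, ENNReal.ofReal (128 * ε ^ 4 * h ^ 2 * (‖v i - v j‖ ^ 2 + ‖v k - v l‖ ^ 2)) ∂Γ :=
        lintegral_mono hsec
    _ = ∫⁻ v, ENNReal.ofReal (128 * ε ^ 4 * h ^ 2) *
          (ENNReal.ofReal (‖v i - v j‖ ^ 2) + ENNReal.ofReal (‖v k - v l‖ ^ 2)) ∂Γ := by
        refine lintegral_congr fun v => ?_
        rw [ENNReal.ofReal_mul (by positivity), ENNReal.ofReal_add (by positivity) (by positivity)]
    _ = ENNReal.ofReal (128 * ε ^ 4 * h ^ 2) *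
          (∫⁻ v, ENNReal.ofReal (‖v i - v j‖ ^ 2) ∂Γ + ∫⁻ v, ENNReal.ofReal (‖v k - v l‖ ^ 2) ∂Γ) := by
        rw [lintegral_const_mul' _ _ ENNReal.ofReal_ne_top, lintegral_add_left (hmeas2 i j)]
    _ = ENNReal.ofReal (256 * ε ^ 4 * h ^ 2) *
          ∫⁻ q, ENNReal.ofReal (‖q.2 - q.1‖ ^ 2) ∂((gaussMeasure u θ).prod (gaussMeasure u θ)) := by
        rw [hpair2 i j hij, hpair2 k l hkl, ← two_mul, ← mul_assoc]
        congr 1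
        rw [show (2 : ℝ≥0∞) = ENNReal.ofReal 2 by norm_num, ← ENNReal.ofReal_mul (by positivity)]
        congr 1; ring

/-! ## Combinatorics of the pair excess -/

/-- **Two would-be pairs not related by the swap contain a would-be triple or two disjoint would-be pairs**
(`W` is symmetric, `RateFloorNoBursts.mem_wouldBePairs_symm`). [folklore] -/
theorem exists_shape_of_ne {n : ℕ} {ε Δ : ℝ} {z : Config n (Fin 3) T3} {p q : Fin n × Fin n}
    (hp : p ∈ wouldBePairs ε Δ z) (hq : q ∈ wouldBePairs ε Δ z) (h1 : q ≠ p) (h2 : q ≠ p.swap) :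
    (∃ a b c : Fin n, a ≠ b ∧ a ≠ c ∧ b ≠ c ∧ (a, b) ∈ wouldBePairs ε Δ z ∧ (a, c) ∈ wouldBePairs ε Δ z) ∨
      (∃ i j k l : Fin n, i ≠ j ∧ i ≠ k ∧ i ≠ l ∧ j ≠ k ∧ j ≠ l ∧ k ≠ l ∧
        (i, j) ∈ wouldBePairs ε Δ z ∧ (k, l) ∈ wouldBePairs ε Δ z) := by
  obtain ⟨i, j⟩ := p; obtain ⟨k, l⟩ := q
  have hij : i ≠ j := ((mem_wouldBePairs_iff ε Δ z (i, j)).1 hp).1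
  have hkl : k ≠ l := ((mem_wouldBePairs_iff ε Δ z (k, l)).1 hq).1
  have hsy := fun a b => mem_wouldBePairs_symm ε Δ z a b
  by_cases hki : k = i
  · subst hki
    have hlj : l ≠ j := fun h => h1 (by rw [h])
    exact Or.inl ⟨k, j, l, hij, hkl, hlj.symm, hp, hq⟩
  by_cases hkj : k = j
  · subst hkj
    have hli : l ≠ i := fun h => h2 (by rw [h]; rfl)
    exact Or.inl ⟨k, i, l, hij.symm, hkl, hli.symm, (hsy i k).1 hp, hq⟩
  by_cases hli : l = i
  · subst hli
    exact Or.inl ⟨l, j, k, hij, Ne.symm hki, Ne.symm hkj, hp, (hsy k l).1 hq⟩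
  by_cases hlj : l = j
  · subst hlj
    exact Or.inl ⟨l, i, k, hij.symm, Ne.symm hkj, Ne.symm hki, (hsy i l).1 hp, (hsy k l).1 hq⟩
  exact Or.inr ⟨i, j, k, l, hij, Ne.symm hki, Ne.symm hli, Ne.symm hkj, Ne.symm hlj, hkl, hp, hq⟩

/-- A single term of a triple sum over `Fin n` is at most the sum (`ℝ≥0∞`). [folklore] -/
theorem single_le_sum₃ {n : ℕ} (f : Fin n → Fin n → Fin n → ℝ≥0∞) (a b c : Fin n) :
    f a b c ≤ ∑ i, ∑ j, ∑ k, f i j k :=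
  calc f a b c ≤ ∑ k, f a b k := Finset.single_le_sum (f := fun k => f a b k) (fun _ _ => bot_le) (Finset.mem_univ c)
    _ ≤ ∑ j, ∑ k, f a j k := Finset.single_le_sum (f := fun j => ∑ k, f a j k) (fun _ _ => bot_le) (Finset.mem_univ b)
    _ ≤ ∑ i, ∑ j, ∑ k, f i j k :=
        Finset.single_le_sum (f := fun i => ∑ j, ∑ k, f i j k) (fun _ _ => bot_le) (Finset.mem_univ a)

/-- A single term of a quadruple sum over `Fin n` is at most the sum (`ℝ≥0∞`). [folklore] -/
theorem single_le_sum₄ {n : ℕ} (f : Fin n → Fin n → Fin n → Fin n → ℝ≥0∞) (a b c d : Fin n) :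
    f a b c d ≤ ∑ i, ∑ j, ∑ k, ∑ l, f i j k l :=
  (single_le_sum₃ (f a) b c d).trans
    (Finset.single_le_sum (f := fun i => ∑ j, ∑ k, ∑ l, f i j k l) (fun _ _ => bot_le) (Finset.mem_univ a))

/-- The pair excess is at most `(N+1)⁴` (crudely: both the outer and the inner count are `≤ (N+1)²`). [folklore] -/
theorem pairExcess_le_pow {N : ℕ} (W : Finset (Fin (N + 1) × Fin (N + 1))) :
    (∑ p ∈ W, (W.filter fun q => q ≠ p ∧ q ≠ p.swap).card) ≤ (N + 1) ^ 4 := by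
  have hW : W.card ≤ (N + 1) ^ 2 := by
    have := Finset.card_le_univ W
    simpa [Fintype.card_prod, Fintype.card_fin, sq] using this
  calc (∑ p ∈ W, (W.filter fun q => q ≠ p ∧ q ≠ p.swap).card) ≤ ∑ _p ∈ W, (N + 1) ^ 2 :=
        Finset.sum_le_sum fun p _ => (Finset.card_filter_le _ _).trans hW
    _ = W.card * (N + 1) ^ 2 := by rw [Finset.sum_const, smul_eq_mul]
    _ ≤ (N + 1) ^ 2 * (N + 1) ^ 2 := Nat.mul_le_mul_right _ hW
    _ = (N + 1) ^ 4 := by ring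

/-! ## The registered helper: a measurable `O_N(h²)` majorant of the pair excess -/

/-- **Registered helper `splitFloorRung0_statics`** (stmt-AtomisticToContinuum-9235, line `level-census-comparison`,
input of `stub_splitFloorRung0`).  For constant profiles, small density, every flow, window `h > 0`: the pair
excess `Σ_{p ∈ W_h(w)} #{q ∈ W_h(w) : q ∉ {p, p.swap}}` of the would-be pairs has a measurable majorant `M` on
the hard-sphere domain with `E_{G_N}[M] ≤ ((N+1)⁷ + (N+1)⁸) · 1024 ε_N⁴ (‖u‖² + 3θ) h²`. [folklore] -/
theorem splitFloorRung0_statics : ∀ (σ : ℝ), 0 < σ → σ ≤ 1 / 2 → SmallDensity uniformProfile σ → ∀ (a θ : ℝ), 0 < a → 0 < θ → ∀ (u : V3) (N : ℕ) (Φ : HardSphereFlow (Torus.geometry (Fin 3)) (hsDiameter σ N) (N + 1)) (h : ℝ), 0 < h → ∃ M : Config (N + 1) (Fin 3) T3 → ℝ≥0∞, Measurable M ∧ (∀ w ∈ hardSphereDomain (Torus.geometry (Fin 3)) (N + 1) (hsDiameter σ N), ((∑ p ∈ wouldBePairs (hsDiameter σ N) h w, ((wouldBePairs (hsDiameter σ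 N) h w).filter fun q => q ≠ p ∧ q ≠ p.swap).card : ℕ) : ℝ≥0∞) ≤ M w) ∧ ∫⁻ w, M w ∂(localGibbsLaw σ (fun _ => a) (fun _ => u) (fun _ => θ) N Φ) ≤ ENNReal.ofReal ((((N + 1 : ℕ) : ℝ) ^ 7 + ((N + 1 : ℕ) : ℝ) ^ 8) * (1024 * hsDiameter σ N ^ 4 * (‖u‖ ^ 2 + 3 * θ) * h ^ 2)) := by
  intro σ hσ hσ2 hsm a θ ha hθ u N Φ h hh
  have hε0 : 0 < hsDiameter σ N := hsDiameter_pos hσ N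
  set P := localGibbsLaw σ (fun _ => a) (fun _ => u) (fun _ => θ) N Φ with hPdef
  -- the swept tube of window `h` and its velocity flip
  obtain ⟨S, hSm, hSvol, hS⟩ := exists_sweptTube (h := h) hε0 hh.le
  set Sn : V3 → Set V3 := fun v => S (-v) with hSn
  have hSnm : MeasurableSet {q : V3 × V3 | q.1 ∈ Sn q.2} :=
    hSm.preimage (measurable_fst.prodMk measurable_snd.neg)
  have hSnvol : ∀ v, volume (Sn v) ≤ ENNReal.ofReal (4 * (hsDiameter σ N) ^ 2 * h * ‖v‖) := fun v => by
    simpa only [hSn, norm_neg] using hSvol (-v)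
  have hlift : ∀ B : Set V3, MeasurableSet B →
      volume {x : T3 | ∃ k : Fin 3 → ℤ, Torus.reprSym x + Torus.latticeVec k ∈ B} ≤ volume B :=
    fun B hB => by simpa only [sub_zero] using volume_setOf_exists_reprSym_add_latticeVec_mem_le 0 hB
  -- the events
  set A : Fin (N + 1) → Fin (N + 1) → Set (Config (N + 1) (Fin 3) T3) := fun p m =>
    {w | ∃ k : Fin 3 → ℤ, Torus.reprSym ((w m).1 - (w p).1) + Torus.latticeVec k ∈ Sn ((w p).2 - (w m).2)}
    with hAdef
  set B : Fin (N + 1) → Fin (N + 1) → Set (Config (N + 1) (Fin 3) T3) := fun p j' =>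
    {w | ∃ k : Fin 3 → ℤ, Torus.reprSym ((w j').1 - (w p).1) + Torus.latticeVec k ∈
      S ((w j').2 - (w p).2) ∪ Sn ((w p).2 - (w j').2)} with hBdef
  have hψm : ∀ (i j i' j'' : Fin (N + 1)) (k : Fin 3 → ℤ), Measurable fun w : Config (N + 1) (Fin 3) T3 =>
      (Torus.reprSym ((w i).1 - (w j).1) + Torus.latticeVec k, (w i').2 - (w j'').2) := fun i j i' j'' k =>
    ((Torus.measurable_reprSym.comp ((measurable_pi_apply i).fst.sub (measurable_pi_apply j).fst)).add_const
      _).prodMk ((measurable_pi_apply i').snd.sub (measurable_pi_apply j'').snd)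
  have hAm : ∀ p m, MeasurableSet (A p m) := fun p m => by
    have h1 : A p m = ⋃ k : Fin 3 → ℤ, (fun w : Config (N + 1) (Fin 3) T3 =>
        (Torus.reprSym ((w m).1 - (w p).1) + Torus.latticeVec k, (w p).2 - (w m).2)) ⁻¹'
          {q : V3 × V3 | q.1 ∈ Sn q.2} := by
      ext w; simp only [hAdef, Set.mem_setOf_eq, Set.mem_iUnion, Set.mem_preimage]
    exact h1 ▸ MeasurableSet.iUnion fun k => hSnm.preimage (hψm m p p m k)
  have hBm : ∀ p j', MeasurableSet (B p j') := fun p j' => by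
    have h2 : B p j' = ⋃ k : Fin 3 → ℤ, ((fun w : Config (N + 1) (Fin 3) T3 =>
          (Torus.reprSym ((w j').1 - (w p).1) + Torus.latticeVec k, (w j').2 - (w p).2)) ⁻¹'
            {q : V3 × V3 | q.1 ∈ S q.2} ∪
          (fun w : Config (N + 1) (Fin 3) T3 =>
            (Torus.reprSym ((w j').1 - (w p).1) + Torus.latticeVec k, (w p).2 - (w j').2)) ⁻¹'
            {q : V3 × V3 | q.1 ∈ Sn q.2}) := by
      ext w; simp only [hBdef, Set.mem_setOf_eq, Set.mem_iUnion, Set.mem_preimage, Set.mem_union]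
    exact h2 ▸ MeasurableSet.iUnion fun k => (hSm.preimage (hψm j' p j' p k)).union (hSnm.preimage (hψm j' p p j' k))
  -- the three- and four-label statics
  set M₂ := ∫⁻ q, ENNReal.ofReal (‖q.2 - q.1‖ ^ 2) ∂((gaussMeasure u θ).prod (gaussMeasure u θ)) with hM₂
  have hM₂le : M₂ ≤ ENNReal.ofReal (4 * (‖u‖ ^ 2 + 3 * θ)) := EvenStressEnskog.lintegral_relSpeed_sq_le u hθ
  set c : ℝ := 256 * (hsDiameter σ N) ^ 4 * h ^ 2 * (4 * (‖u‖ ^ 2 + 3 * θ)) with hc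
  have hkey3 : ∀ p m j' : Fin (N + 1), p ≠ m → p ≠ j' → m ≠ j' → P (A p m ∩ B p j') ≤ ENNReal.ofReal c := by
    intro p m j' hpm hpj hmj
    refine (measure_windowEvent_inter_tubeEvent_le hσ2 ha hθ u Φ hpm hpj (fun T T' hT hT' =>
      posGibbs_tripleEvent_le hsm hpm hpj hmj hT hT') hh.le hh.le hSnm hSm hSnvol hSvol hlift).trans ?_
    rw [hc, ENNReal.ofReal_mul (by positivity : (0 : ℝ) ≤ 256 * (hsDiameter σ N) ^ 4 * h ^ 2),
      show 128 * hsDiameter σ N ^ 4 * h * (h + h) = 256 * hsDiameter σ N ^ 4 * h ^ 2 by ring]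
    gcongr
  have hkey4 : ∀ i j k l : Fin (N + 1), i ≠ j → i ≠ k → i ≠ l → j ≠ k → j ≠ l → k ≠ l →
      P (A i j ∩ A k l) ≤ ENNReal.ofReal c := by
    intro i j k l hij hik hil hjk hjl hkl
    refine (measure_tubeEvent_inter_tubeEvent_le hσ2 ha hθ u Φ hij hkl (fun T T' hT hT' =>
      posGibbs_quadEvent_le hsm hij hik hil hjk hjl hkl hT hT') hh.le hSnm hSnvol hlift).trans ?_
    rw [hc, ENNReal.ofReal_mul (by positivity : (0 : ℝ) ≤ 256 * (hsDiameter σ N) ^ 4 * h ^ 2)]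
    gcongr
  -- covering: would-be pairs put the configuration in the events
  have hcovA : ∀ w ∈ hardSphereDomain (Torus.geometry (Fin 3)) (N + 1) (hsDiameter σ N), ∀ p m : Fin (N + 1),
      (m, p) ∈ wouldBePairs (hsDiameter σ N) h w → w ∈ A p m := by
    intro w hw p m hmp
    obtain ⟨hne, hwb⟩ := (mem_wouldBePairs_iff (hsDiameter σ N) h w (m, p)).1 hmp
    obtain ⟨k, hk⟩ := exists_latticeVec_mem_of_wouldBe hS hw hne hwb
    refine ⟨k, ?_⟩
    show Torus.reprSym ((w m).1 - (w p).1) + Torus.latticeVec k ∈ S (-((w p).2 - (w m).2))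
    exact (neg_sub (w p).2 (w m).2).symm ▸ hk
  have hcovB : ∀ w ∈ hardSphereDomain (Torus.geometry (Fin 3)) (N + 1) (hsDiameter σ N), ∀ p j' : Fin (N + 1),
      (j', p) ∈ wouldBePairs (hsDiameter σ N) h w → w ∈ B p j' := by
    intro w hw p j' hjp
    obtain ⟨hne, hwb⟩ := (mem_wouldBePairs_iff (hsDiameter σ N) h w (j', p)).1 hjp
    obtain ⟨k, hk⟩ := exists_latticeVec_mem_of_wouldBe hS hw hne hwb
    exact ⟨k, Or.inl hk⟩
  -- the static majorant
  set f₃ : Fin (N + 1) → Fin (N + 1) → Fin (N + 1) → Config (N + 1) (Fin 3) T3 → ℝ≥0∞ := fun p m j' w =>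
    if p ≠ m ∧ p ≠ j' ∧ m ≠ j' then (A p m ∩ B p j').indicator 1 w else 0 with hf₃
  set f₄ : Fin (N + 1) → Fin (N + 1) → Fin (N + 1) → Fin (N + 1) → Config (N + 1) (Fin 3) T3 → ℝ≥0∞ :=
    fun i j k l w => if i ≠ j ∧ i ≠ k ∧ i ≠ l ∧ j ≠ k ∧ j ≠ l ∧ k ≠ l then (A i j ∩ A k l).indicator 1 w else 0
    with hf₄
  have hf₃m : ∀ p m j', Measurable (f₃ p m j') := fun p m j' => by
    by_cases hcd : p ≠ m ∧ p ≠ j' ∧ m ≠ j'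
    · simp only [hf₃, if_pos hcd]; exact measurable_one.indicator ((hAm p m).inter (hBm p j'))
    · simp only [hf₃, if_neg hcd]; exact measurable_const
  have hf₄m : ∀ i j k l, Measurable (f₄ i j k l) := fun i j k l => by
    by_cases hcd : i ≠ j ∧ i ≠ k ∧ i ≠ l ∧ j ≠ k ∧ j ≠ l ∧ k ≠ l
    · simp only [hf₄, if_pos hcd]; exact measurable_one.indicator ((hAm i j).inter (hAm k l))
    · simp only [hf₄, if_neg hcd]; exact measurable_const
  set M₀ : Config (N + 1) (Fin 3) T3 → ℝ≥0∞ := fun w =>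
    (∑ p, ∑ m, ∑ j', f₃ p m j' w) + ∑ i, ∑ j, ∑ k, ∑ l, f₄ i j k l w with hM₀
  have hS3m : Measurable fun w => ∑ p, ∑ m, ∑ j', f₃ p m j' w :=
    Finset.measurable_sum _ fun p _ => Finset.measurable_sum _ fun m _ => Finset.measurable_sum _ fun j' _ => hf₃m p m j'
  have hS4m : Measurable fun w => ∑ i, ∑ j, ∑ k, ∑ l, f₄ i j k l w :=
    Finset.measurable_sum _ fun i _ => Finset.measurable_sum _ fun j _ => Finset.measurable_sum _ fun k _ =>
      Finset.measurable_sum _ fun l _ => hf₄m i j k l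
  have hM₀m : Measurable M₀ := hS3m.add hS4m
  -- the shapes force `M₀ ≥ 1`
  have hM₀ge : ∀ w ∈ hardSphereDomain (Torus.geometry (Fin 3)) (N + 1) (hsDiameter σ N),
      ∀ p ∈ wouldBePairs (hsDiameter σ N) h w, ∀ q ∈ wouldBePairs (hsDiameter σ N) h w, q ≠ p → q ≠ p.swap →
      1 ≤ M₀ w := by
    intro w hw p hp q hq h1 h2
    rcases exists_shape_of_ne hp hq h1 h2 with ⟨a', b, c', hab, hac, hbc, hab', hac'⟩ |
      ⟨i, j, k, l, hij, hik, hil, hjk, hjl, hkl, hij', hkl'⟩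
    · have hwA : w ∈ A a' b := hcovA w hw a' b ((mem_wouldBePairs_symm (hsDiameter σ N) h w a' b).1 hab')
      have hwB : w ∈ B a' c' := hcovB w hw a' c' ((mem_wouldBePairs_symm (hsDiameter σ N) h w a' c').1 hac')
      have h1' : f₃ a' b c' w = 1 := by
        simp only [hf₃, if_pos (And.intro hab (And.intro hac hbc)), Set.indicator_of_mem (Set.mem_inter hwA hwB),
          Pi.one_apply]
      calc (1 : ℝ≥0∞) = f₃ a' b c' w := h1'.symm
        _ ≤ ∑ p, ∑ m, ∑ j', f₃ p m j' w := single_le_sum₃ (fun p m j' => f₃ p m j' w) a' b c'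
        _ ≤ M₀ w := le_self_add
    · have hwA : w ∈ A i j := hcovA w hw i j ((mem_wouldBePairs_symm (hsDiameter σ N) h w i j).1 hij')
      have hwA' : w ∈ A k l := hcovA w hw k l ((mem_wouldBePairs_symm (hsDiameter σ N) h w k l).1 hkl')
      have h1' : f₄ i j k l w = 1 := by
        simp only [hf₄, if_pos (And.intro hij (And.intro hik (And.intro hil (And.intro hjk (And.intro hjl hkl))))),
          Set.indicator_of_mem (Set.mem_inter hwA hwA'), Pi.one_apply]
      calc (1 : ℝ≥0∞) = f₄ i j k l w := h1'.symm
        _ ≤ ∑ i, ∑ j, ∑ k, ∑ l, f₄ i j k l w := single_le_sum₄ (fun i j k l => f₄ i j k l w) i j k l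
        _ ≤ M₀ w := le_add_self
  -- the majorant `M = (N+1)⁴ M₀`
  refine ⟨fun w => ((N + 1 : ℕ) : ℝ≥0∞) ^ 4 * M₀ w, hM₀m.const_mul _, ?_, ?_⟩
  · intro w hw
    set W := wouldBePairs (hsDiameter σ N) h w with hW
    by_cases hD : (∑ p ∈ W, (W.filter fun q => q ≠ p ∧ q ≠ p.swap).card) = 0
    · rw [hD, Nat.cast_zero]; exact bot_le
    · obtain ⟨p, hp, hp0⟩ := Finset.exists_ne_zero_of_sum_ne_zero hD
      obtain ⟨q, hq⟩ := Finset.card_ne_zero.1 hp0; rw [Finset.mem_filter] at hq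
      have h1 := hM₀ge w hw p hp q hq.1 hq.2.1 hq.2.2
      calc ((∑ p ∈ W, (W.filter fun q => q ≠ p ∧ q ≠ p.swap).card : ℕ) : ℝ≥0∞)
          ≤ (((N + 1) ^ 4 : ℕ) : ℝ≥0∞) := by exact_mod_cast pairExcess_le_pow W
        _ = ((N + 1 : ℕ) : ℝ≥0∞) ^ 4 * 1 := by push_cast; ring
        _ ≤ ((N + 1 : ℕ) : ℝ≥0∞) ^ 4 * M₀ w := by gcongr
  · -- the mean
    have hI3 : ∫⁻ w, ∑ p, ∑ m, ∑ j', f₃ p m j' w ∂P ≤ ((N + 1 : ℕ) : ℝ≥0∞) ^ 3 * ENNReal.ofReal c := by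
      have hterm : ∀ p m j', ∫⁻ w, f₃ p m j' w ∂P ≤ ENNReal.ofReal c := fun p m j' => by
        by_cases hcd : p ≠ m ∧ p ≠ j' ∧ m ≠ j'
        · simp only [hf₃, if_pos hcd]
          rw [lintegral_indicator_one ((hAm p m).inter (hBm p j'))]
          exact hkey3 p m j' hcd.1 hcd.2.1 hcd.2.2
        · simp only [hf₃, if_neg hcd, lintegral_const, zero_mul, zero_le]
      calc ∫⁻ w, ∑ p, ∑ m, ∑ j', f₃ p m j' w ∂P = ∑ p, ∑ m, ∑ j', ∫⁻ w, f₃ p m j' w ∂P := by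
            rw [lintegral_finsetSum _ fun p _ => Finset.measurable_sum _ fun m _ =>
              Finset.measurable_sum _ fun j' _ => hf₃m p m j']
            refine Finset.sum_congr rfl fun p _ => ?_
            rw [lintegral_finsetSum _ fun m _ => Finset.measurable_sum _ fun j' _ => hf₃m p m j']
            exact Finset.sum_congr rfl fun m _ => lintegral_finsetSum _ fun j' _ => hf₃m p m j'
        _ ≤ ∑ _p : Fin (N + 1), ∑ _m : Fin (N + 1), ∑ _j' : Fin (N + 1), ENNReal.ofReal c := by
            gcongr with p _ m _ j' _
            exact hterm p m j'
        _ = ((N + 1 : ℕ) : ℝ≥0∞) ^ 3 * ENNReal.ofReal c := by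
            simp only [Finset.sum_const, Finset.card_univ, Fintype.card_fin, nsmul_eq_mul]; ring
    have hI4 : ∫⁻ w, ∑ i, ∑ j, ∑ k, ∑ l, f₄ i j k l w ∂P ≤ ((N + 1 : ℕ) : ℝ≥0∞) ^ 4 * ENNReal.ofReal c := by
      have hterm : ∀ i j k l, ∫⁻ w, f₄ i j k l w ∂P ≤ ENNReal.ofReal c := fun i j k l => by
        by_cases hcd : i ≠ j ∧ i ≠ k ∧ i ≠ l ∧ j ≠ k ∧ j ≠ l ∧ k ≠ l
        · simp only [hf₄, if_pos hcd]
          rw [lintegral_indicator_one ((hAm i j).inter (hAm k l))]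
          exact hkey4 i j k l hcd.1 hcd.2.1 hcd.2.2.1 hcd.2.2.2.1 hcd.2.2.2.2.1 hcd.2.2.2.2.2
        · simp only [hf₄, if_neg hcd, lintegral_const, zero_mul, zero_le]
      calc ∫⁻ w, ∑ i, ∑ j, ∑ k, ∑ l, f₄ i j k l w ∂P = ∑ i, ∑ j, ∑ k, ∑ l, ∫⁻ w, f₄ i j k l w ∂P := by
            rw [lintegral_finsetSum _ fun i _ => Finset.measurable_sum _ fun j _ =>
              Finset.measurable_sum _ fun k _ => Finset.measurable_sum _ fun l _ => hf₄m i j k l]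
            refine Finset.sum_congr rfl fun i _ => ?_
            rw [lintegral_finsetSum _ fun j _ => Finset.measurable_sum _ fun k _ =>
              Finset.measurable_sum _ fun l _ => hf₄m i j k l]
            refine Finset.sum_congr rfl fun j _ => ?_
            rw [lintegral_finsetSum _ fun k _ => Finset.measurable_sum _ fun l _ => hf₄m i j k l]
            exact Finset.sum_congr rfl fun k _ => lintegral_finsetSum _ fun l _ => hf₄m i j k l
        _ ≤ ∑ _i : Fin (N + 1), ∑ _j : Fin (N + 1), ∑ _k : Fin (N + 1), ∑ _l : Fin (N + 1), ENNReal.ofReal c := by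
            gcongr with i _ j _ k _ l _
            exact hterm i j k l
        _ = ((N + 1 : ℕ) : ℝ≥0∞) ^ 4 * ENNReal.ofReal c := by
            simp only [Finset.sum_const, Finset.card_univ, Fintype.card_fin, nsmul_eq_mul]; ring
    have hn : ((N + 1 : ℕ) : ℝ≥0∞) = ENNReal.ofReal ((N + 1 : ℕ) : ℝ) := (ENNReal.ofReal_natCast _).symm
    calc ∫⁻ w, ((N + 1 : ℕ) : ℝ≥0∞) ^ 4 * M₀ w ∂P = ((N + 1 : ℕ) : ℝ≥0∞) ^ 4 * ∫⁻ w, M₀ w ∂P :=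
          lintegral_const_mul _ hM₀m
      _ = ((N + 1 : ℕ) : ℝ≥0∞) ^ 4 * (∫⁻ w, ∑ p, ∑ m, ∑ j', f₃ p m j' w ∂P +
            ∫⁻ w, ∑ i, ∑ j, ∑ k, ∑ l, f₄ i j k l w ∂P) := by rw [hM₀, lintegral_add_left hS3m]
      _ ≤ ((N + 1 : ℕ) : ℝ≥0∞) ^ 4 * (((N + 1 : ℕ) : ℝ≥0∞) ^ 3 * ENNReal.ofReal c +
            ((N + 1 : ℕ) : ℝ≥0∞) ^ 4 * ENNReal.ofReal c) := by gcongr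
      _ = ENNReal.ofReal (((N + 1 : ℕ) : ℝ) ^ 4 * (((N + 1 : ℕ) : ℝ) ^ 3 * c + ((N + 1 : ℕ) : ℝ) ^ 4 * c)) := by
          rw [hn, ← ENNReal.ofReal_pow (Nat.cast_nonneg _), ← ENNReal.ofReal_pow (Nat.cast_nonneg _),
            ← ENNReal.ofReal_mul (by positivity), ← ENNReal.ofReal_mul (by positivity),
            ← ENNReal.ofReal_add (by positivity) (by positivity), ← ENNReal.ofReal_mul (by positivity)]
      _ = _ := by rw [hc]; congr 1; ring

end Summit.AtomisticToContinuum.HydrodynamicLimit.Theorems.EnergyCurrentTailsLevelCensus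

end
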